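import Summits.QuantumFields.YangMills.Theorems.DiagonalMirrorRPRWilsonDiagonalModelBlockChain

/-!
# Crux `WeakCouplingHypercubicLimitRP` (stmt-QuantumFields-27398) / aside `DiagonalMirrorRPR` (stmt-QuantumFields-10604), door B,
# construction F1_diag — PAIRING LAYER, step P3d: the SANDWICH FORM `∫ k̃W(V₀,V₁) 𝔟(V₁,V₂) ⋯ 𝔟(V_n,V₀) dμ̃^{⊗(n+1)}`

Helper file (`--supports stmt-QuantumFields-27398 --as helper`) of the hand `hand-10604-wilsonDiagModel-2` (docket director-ym O4 WORD 16 (1) /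
28, step P3 of hand-1's ROADMAP-F1diag v4 §1⅞); it closes nothing by itself.

WHAT.  `…BlockChain` factorised the reflected two-point insertion on the chain `ℤ/mℤ`, `m = n + 2e + 2`, into the free reweighted lifted
kernels times the two half blocks.  Here the lifted sites are regrouped — window `V_{e+1}, …, V_{e+1+n}` (the `n + 1` chain states), centre
`V_0`, left interior `V_{-1}, …, V_{-e}`, right interior `V_1, …, V_e` (`…ProductMarginals.integral_pi_split`) — and the interior
integrations are performed: by Fubini on the FINITE measure `μ̃` they assemble exactly hand-2's Gram block kernel
`blockKernel f x y = ∫ halfBlockT(v₀,x) halfBlockT(v₀,y) dμ̃(v₀)` (`…OpenLink`) between the two window ends: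
* §1 index bookkeeping (the four site groups are disjoint and exhaust `ℤ/mℤ`);
* §2 ★★ **`integral_obsLR_mul_pairChain_eq_blockKernel`**:
  `∫ Θf · f · ∏_t e^{β even_t} e^{β odd_t} dP = ∫ (∏_{j<n} 𝔟(W_j, W_{j+1})) · blockKernel f (W_n) (W_0) dμ̃^{⊗(n+1)}(W)`;
* §3 ★★ **`integral_obsLR_mul_pairChain_eq_sandwich`** — the same in the layout of the tree's sandwiched trace formula
  (`Literature/…/PositiveKernelSpectralTrace.hasSum_integral_iterate_insert_one` + `HermitianKernelSandwichedTrace.integral_cyclic_bond_insert_…`):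
  `= ∫ blockKernel f (V 0) (V 1) · ∏_{t : Fin n} 𝔟(V (t+1), V (t+2)) dμ̃^{⊗ Fin (n+1)}(V)`.

HONEST FRAMING: bookkeeping of the pairing layer; `wilsonDiagonalModel` is NOT landed here; no letter is proved; D1, ⟨27398⟩, S6i and the aside
⟨10604⟩ are OPEN; nothing here bears on the summit; the Yang–Mills mass gap is NOT proved here or anywhere in the tree.  No definition, no
instance, no notation, `autoImplicit false`.

References: K. Osterwalder, E. Seiler, Ann. Phys. 110 (1978) §2–3; E. Seiler, LNP 159 (1982) Ch. 2; B. Simon, *Trace Ideals* (2005) Ch. 3.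
-/

set_option autoImplicit false

noncomputable section

open scoped BigOperators ENNReal
open MeasureTheory Function
open Literature.MathematicalPhysics.QuantumLattice Literature.MathematicalPhysics.QuantumFieldTheory
open Summit.QuantumFields.YangMills.Cruxes.DiagonalMirrorRPR.ParityBridgeColdTraces

namespace Summit.QuantumFields.YangMills.Cruxes.DiagonalMirrorRPR.SignTwistedDiagonalTrace.WilsonDiagonal

/-! ## §1 Index bookkeeping: window, centre, left interior, right interior -/

section Index

variable {m : ℕ}

/-- The four site groups — window `e+1, …, e+1+n`, centre `0`, left interior `-1, …, -e`, right interior `1, …, e` — as one map from the sum type;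
it is injective when `m = n + 2e + 2`. -/
theorem siteGroups_injective {n e : ℕ} (hm : m = n + 2 * e + 2) :
    Function.Injective (Sum.elim (fun j : Fin (n + 1) => ((e + 1 + (j : ℕ) : ℕ) : ZMod m))
      (Sum.elim (fun _ : Unit => ((0 : ℕ) : ZMod m))
        (Sum.elim (fun i : Fin e => -((((i : ℕ) + 1 : ℕ)) : ZMod m)) (fun i : Fin e => ((((i : ℕ) + 1 : ℕ)) : ZMod m))))) := by
  intro s s' h
  rcases s with j | u | i | i <;> rcases s' with j' | u' | i' | i' <;>
    simp only [Sum.elim_inl, Sum.elim_inr] at h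
  · have := natCast_zmod_injOn (m := m) (by omega) (by omega) h
    exact congrArg _ (Fin.ext (by omega))
  · exact absurd (natCast_zmod_injOn (m := m) (by omega) (by omega) h) (by omega)
  · exfalso
    have h2 : (((e + 1 + (j : ℕ) + ((i' : ℕ) + 1) : ℕ)) : ZMod m) = 0 := by
      push_cast at h ⊢; linear_combination h
    exact natCast_zmod_ne_zero (m := m) (by omega) (by omega) h2
  · exact absurd (natCast_zmod_injOn (m := m) (by omega) (by omega) h) (by omega)
  · exact absurd (natCast_zmod_injOn (m := m) (by omega) (by omega) h) (by omega)
  · rfl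
  · exfalso
    have h2 : ((((i' : ℕ) + 1 : ℕ)) : ZMod m) = 0 := by
      push_cast at h ⊢; linear_combination h
    exact natCast_zmod_ne_zero (m := m) (by omega) (by omega) h2
  · exact absurd (natCast_zmod_injOn (m := m) (by omega) (by omega) h) (by omega)
  · exfalso
    have h2 : (((e + 1 + (j' : ℕ) + ((i : ℕ) + 1) : ℕ)) : ZMod m) = 0 := by
      push_cast at h ⊢; linear_combination -h
    exact natCast_zmod_ne_zero (m := m) (by omega) (by omega) h2
  · exfalso
    have h2 : ((((i : ℕ) + 1 : ℕ)) : ZMod m) = 0 := by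
      push_cast at h ⊢; linear_combination -h
    exact natCast_zmod_ne_zero (m := m) (by omega) (by omega) h2
  · have h1 : ((((i : ℕ) + 1 : ℕ)) : ZMod m) = ((((i' : ℕ) + 1 : ℕ)) : ZMod m) := neg_injective h
    have := natCast_zmod_injOn (m := m) (by omega) (by omega) h1
    exact congrArg _ (congrArg _ (congrArg _ (Fin.ext (by omega))))
  · exfalso
    have h2 : ((((i : ℕ) + 1 + ((i' : ℕ) + 1) : ℕ)) : ZMod m) = 0 := by
      push_cast at h ⊢; linear_combination -h
    exact natCast_zmod_ne_zero (m := m) (by omega) (by omega) h2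
  · exact absurd (natCast_zmod_injOn (m := m) (by omega) (by omega) h) (by omega)
  · exfalso
    have h2 : ((((i : ℕ) + 1 : ℕ)) : ZMod m) = 0 := by
      push_cast at h ⊢; linear_combination h
    exact natCast_zmod_ne_zero (m := m) (by omega) (by omega) h2
  · exfalso
    have h2 : ((((i' : ℕ) + 1 + ((i : ℕ) + 1) : ℕ)) : ZMod m) = 0 := by
      push_cast at h ⊢; linear_combination h
    exact natCast_zmod_ne_zero (m := m) (by omega) (by omega) h2
  · have := natCast_zmod_injOn (m := m) (by omega) (by omega) h
    exact congrArg _ (congrArg _ (congrArg _ (Fin.ext (by omega))))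

variable [NeZero m]

/-- The four site groups exhaust the cycle. -/
theorem siteGroups_bijective {n e : ℕ} (hm : m = n + 2 * e + 2) :
    Function.Bijective (Sum.elim (fun j : Fin (n + 1) => ((e + 1 + (j : ℕ) : ℕ) : ZMod m))
      (Sum.elim (fun _ : Unit => ((0 : ℕ) : ZMod m))
        (Sum.elim (fun i : Fin e => -((((i : ℕ) + 1 : ℕ)) : ZMod m)) (fun i : Fin e => ((((i : ℕ) + 1 : ℕ)) : ZMod m))))) := by
  rw [Fintype.bijective_iff_injective_and_card]
  refine ⟨siteGroups_injective hm, ?_⟩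
  simp only [Fintype.card_sum, Fintype.card_fin, Fintype.card_unit, ZMod.card]
  omega

end Index

/-! ## §2 ★★ Interior integrations: the block kernel between the window ends -/

section Sandwich

variable {S : ℕ} [NeZero S] {G : Type} [Group G] {Nc : ℕ} (ρ : G →* Matrix (Fin Nc) (Fin Nc) ℂ)
variable [TopologicalSpace G] [IsTopologicalGroup G] [CompactSpace G] [MeasurableSpace G] [BorelSpace G]
  [SecondCountableTopology G]

omit [NeZero S] [Group G] [TopologicalSpace G] [IsTopologicalGroup G] [CompactSpace G] [BorelSpace G]
  [SecondCountableTopology G] in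
/-- Joining two coordinate blocks along an index equivalence is measurable. -/
theorem measurable_sumElim_symm {ι κ κ' : Type} (ε : κ ⊕ κ' ≃ ι) :
    Measurable fun p : (κ → ℕ × HalfCfg S S G) × (κ' → ℕ × HalfCfg S S G) => fun i => Sum.elim p.1 p.2 (ε.symm i) := by
  refine measurable_pi_lambda _ fun i => ?_
  generalize ε.symm i = s
  rcases s with j | j'
  · exact (measurable_pi_apply j).comp measurable_fst
  · exact (measurable_pi_apply j').comp measurable_snd

/-- ★★ **The block kernel between the window ends** (`β ≥ 0`, `ρ` continuous unitary, `|w(Y)_j| ≤ M`, `m = n + 2e + 2`, `f` of depth `e+1`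
bounded measurable): `∫ Θf · f · ∏_t e^{β even_t} e^{β odd_t} dP = ∫ (∏_{j<n} 𝔟(W_j, W_{j+1})) · blockKernel f (W_n) (W_0) dμ̃^{⊗(n+1)}(W)` —
window site `W_j` is the chain layer `e + 1 + j` (`W_0 = V_d`, `W_n = V_{-d}`). -/
theorem integral_obsLR_mul_pairChain_eq_blockKernel (hρ : Continuous ρ) {β : ℝ} (hβ : 0 ≤ β)
    (hρu : ∀ g, ρ g ∈ Matrix.unitaryGroup (Fin Nc) ℂ) {M : ℝ}
    (hM : ∀ (Y : HalfCfg S S G) (j : Fin (featDim S Nc)), |bondVec ρ Y j| ≤ M) {m n e : ℕ} [NeZero m]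
    (hm : m = n + 2 * e + 2) {f : (Fin (e + 1) → HalfCfg S S G) → (Fin (e + 1) → HalfCfg S S G) → ℝ}
    (hf : Measurable (uncurry f)) {B : ℝ} (hB : ∀ Y X, |f Y X| ≤ B) :
    ∫ P : ZMod m → HalfCfg S S G × HalfCfg S S G,
        obsL f P * obsR f P * ∏ t : ZMod m, Real.exp (β * evenActionU ρ (P t).1 (P t).2 (P (t + 1)).1) *
          Real.exp (β * oddActionU ρ (P t).2 (P (t + 1)).1 (P (t + 1)).2)
        ∂(Measure.pi fun _ : ZMod m => (halfHaar S G).prod (halfHaar S G)) =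
      ∫ W : Fin (n + 1) → ℕ × HalfCfg S S G,
        (∏ j : Fin n, bKernel ρ β M (W (Fin.castSucc j)) (W j.succ)) * blockKernel S G Nc ρ β M f (W (Fin.last n)) (W 0)
        ∂(Measure.pi fun _ => tMeasure S G Nc β M) := by
  haveI := isFiniteMeasure_tMeasure (S := S) (G := G) (Nc := Nc) hβ M
  rw [integral_obsLR_mul_pairChain_eq ρ hρ hβ hρu hM hm hf hB]
  -- bounds and measurability of the pieces
  obtain ⟨Cb, hCb⟩ := exists_abs_bKernel_le ρ hρ β hM
  obtain ⟨C, hC0, hC⟩ := exists_abs_openLink_le ρ hρ β hM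
  have hB0 : 0 ≤ B := (abs_nonneg _).trans (hB (fun _ _ => 1) (fun _ _ => 1))
  have hCb0 : 0 ≤ Cb := (norm_nonneg _).trans (hCb ((0 : ℕ), fun _ => 1) ((0 : ℕ), fun _ => 1))
  have hHb : ∀ v, |halfBlock ρ β M f v| ≤ C ^ (e + 1) * B := abs_halfBlock_le ρ β M hC0.le hC hB
  have hHm : Measurable (halfBlock ρ β M f) := measurable_halfBlock ρ hρ β M hf
  have hbm : Measurable fun q : (ℕ × HalfCfg S S G) × (ℕ × HalfCfg S S G) => bKernel ρ β M q.1 q.2 :=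
    (stronglyMeasurable_bKernel (S := S) ρ hρ β M).measurable
  -- the four site groups
  set ψ : Fin (n + 1) ⊕ (Unit ⊕ (Fin e ⊕ Fin e)) → ZMod m := Sum.elim (fun j : Fin (n + 1) => ((e + 1 + (j : ℕ) : ℕ) : ZMod m))
      (Sum.elim (fun _ : Unit => ((0 : ℕ) : ZMod m))
        (Sum.elim (fun i : Fin e => -((((i : ℕ) + 1 : ℕ)) : ZMod m)) (fun i : Fin e => ((((i : ℕ) + 1 : ℕ)) : ZMod m)))) with hψ
  have hbij : Function.Bijective ψ := siteGroups_bijective hm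
  set ε : Fin (n + 1) ⊕ (Unit ⊕ (Fin e ⊕ Fin e)) ≃ ZMod m := Equiv.ofBijective ψ hbij with hε
  have hεψ : ∀ s, ε.symm (ψ s) = s := fun s => by
    rw [show ψ s = ε s from rfl, Equiv.symm_apply_apply]
  -- the integrand and its factorised form on joined coordinates
  set F : (ZMod m → ℕ × HalfCfg S S G) → ℝ := fun V =>
    (∏ j : Fin n, bKernel ρ β M (V ((e + 1 + (j : ℕ) : ℕ) : ZMod m)) (V ((e + 2 + (j : ℕ) : ℕ) : ZMod m))) *
      (halfBlock ρ β M f (fun j : Fin (e + 2) => V (-(((j : ℕ) : ℕ) : ZMod m))) *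
        halfBlock ρ β M f (fun j : Fin (e + 2) => V (((j : ℕ) : ℕ) : ZMod m))) with hF
  have hFm : Measurable F := by
    have hb' : ∀ a b : ZMod m, Measurable fun V : ZMod m → ℕ × HalfCfg S S G => bKernel ρ β M (V a) (V b) := fun a b => by
      have h := hbm.comp ((measurable_pi_apply a).prodMk (measurable_pi_apply b) :
        Measurable fun V : ZMod m → ℕ × HalfCfg S S G => (V a, V b))
      simpa only [Function.comp_def] using h
    have hH' : ∀ c : Fin (e + 2) → ZMod m, Measurable fun V : ZMod m → ℕ × HalfCfg S S G => halfBlock ρ β M f (fun k => V (c k)) :=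
      fun c => by
      have h := hHm.comp (measurable_pi_lambda _ fun k => measurable_pi_apply (c k) :
        Measurable fun V : ZMod m → ℕ × HalfCfg S S G => fun k => V (c k))
      simpa only [Function.comp_def] using h
    exact (Finset.measurable_prod _ fun j _ => hb' _ _).mul ((hH' fun k => -(((k : ℕ) : ℕ) : ZMod m)).mul (hH' fun k => (((k : ℕ) : ℕ) : ZMod m)))
  have hFb : ∀ V, |F V| ≤ Cb ^ n * ((C ^ (e + 1) * B) * (C ^ (e + 1) * B)) := fun V => by
    simp only [hF]
    rw [abs_mul, abs_mul, Finset.abs_prod]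
    refine mul_le_mul ?_ (mul_le_mul (hHb _) (hHb _) (abs_nonneg _) (by positivity)) (by positivity) (by positivity)
    calc ∏ j : Fin n, |bKernel ρ β M (V ((e + 1 + (j : ℕ) : ℕ) : ZMod m)) (V ((e + 2 + (j : ℕ) : ℕ) : ZMod m))| ≤ ∏ _j : Fin n, Cb :=
          Finset.prod_le_prod (fun j _ => abs_nonneg _) fun j _ => by simpa only [Real.norm_eq_abs] using hCb _ _
      _ = Cb ^ n := by rw [Finset.prod_const, Finset.card_univ, Fintype.card_fin]
  -- the factorised integrand as a function of (window, centre, left interior, right interior)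
  set Φ : (Fin (n + 1) → ℕ × HalfCfg S S G) → (ℕ × HalfCfg S S G) → (Fin e → ℕ × HalfCfg S S G) →
      (Fin e → ℕ × HalfCfg S S G) → ℝ := fun W c UL UR =>
    halfBlock ρ β M f (Fin.cons c (Fin.snoc UL (W (Fin.last n)))) * halfBlock ρ β M f (Fin.cons c (Fin.snoc UR (W 0))) with hΦ
  have hkey : ∀ (W : Fin (n + 1) → ℕ × HalfCfg S S G) (R : Unit ⊕ (Fin e ⊕ Fin e) → ℕ × HalfCfg S S G),
      F (fun t => Sum.elim W R (ε.symm t)) =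
        (∏ j : Fin n, bKernel ρ β M (W (Fin.castSucc j)) (W j.succ)) *
          Φ W (R (Sum.inl ())) (fun i => R (Sum.inr (Sum.inl i))) (fun i => R (Sum.inr (Sum.inr i))) := by
    intro W R
    -- evaluations of the joined configuration at the relevant layers
    have hW : ∀ j : Fin (n + 1), Sum.elim W R (ε.symm (((e + 1 + (j : ℕ) : ℕ) : ZMod m))) = W j := fun j => by
      rw [show (((e + 1 + (j : ℕ) : ℕ) : ZMod m)) = ψ (Sum.inl j) from rfl, hεψ]; rfl
    have hc : Sum.elim W R (ε.symm 0) = R (Sum.inl ()) := by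
      rw [show (0 : ZMod m) = ψ (Sum.inr (Sum.inl ())) by simp [hψ], hεψ]; rfl
    have hL : ∀ i : Fin e, Sum.elim W R (ε.symm (-((((i : ℕ) + 1 : ℕ)) : ZMod m))) = R (Sum.inr (Sum.inl i)) := fun i => by
      rw [show (-((((i : ℕ) + 1 : ℕ)) : ZMod m)) = ψ (Sum.inr (Sum.inr (Sum.inl i))) from rfl, hεψ]; rfl
    have hR : ∀ i : Fin e, Sum.elim W R (ε.symm (((((i : ℕ) + 1 : ℕ)) : ZMod m))) = R (Sum.inr (Sum.inr i)) := fun i => by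
      rw [show (((((i : ℕ) + 1 : ℕ)) : ZMod m)) = ψ (Sum.inr (Sum.inr (Sum.inr i))) from rfl, hεψ]; rfl
    have hlast : (-(((e + 1 : ℕ)) : ZMod m)) = ((e + 1 + ((Fin.last n : Fin (n + 1)) : ℕ) : ℕ) : ZMod m) := by
      rw [Fin.val_last, neg_eq_iff_add_eq_zero, ← Nat.cast_add, show e + 1 + (e + 1 + n) = m by omega, ZMod.natCast_self]
    -- the three site vectors
    have hvL : (fun j : Fin (e + 2) => Sum.elim W R (ε.symm (-(((j : ℕ) : ℕ) : ZMod m)))) =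
        Fin.cons (R (Sum.inl ())) (Fin.snoc (fun i => R (Sum.inr (Sum.inl i))) (W (Fin.last n))) := by
      funext j
      refine Fin.cases ?_ (fun j' => ?_) j
      · simp only [Fin.val_zero, Nat.cast_zero, neg_zero, Fin.cons_zero]
        exact hc
      · rw [Fin.cons_succ]
        refine Fin.lastCases ?_ (fun i => ?_) j'
        · rw [Fin.snoc_last, Fin.val_succ, Fin.val_last, hlast, hW]
        · rw [Fin.snoc_castSucc, Fin.val_succ, Fin.val_castSucc, hL]
    have hvR : (fun j : Fin (e + 2) => Sum.elim W R (ε.symm ((((j : ℕ) : ℕ) : ZMod m)))) =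
        Fin.cons (R (Sum.inl ())) (Fin.snoc (fun i => R (Sum.inr (Sum.inr i))) (W 0)) := by
      funext j
      refine Fin.cases ?_ (fun j' => ?_) j
      · simp only [Fin.val_zero, Nat.cast_zero, Fin.cons_zero]
        exact hc
      · rw [Fin.cons_succ]
        refine Fin.lastCases ?_ (fun i => ?_) j'
        · rw [Fin.snoc_last, Fin.val_succ, Fin.val_last]
          have h0 : (((e + 1 : ℕ)) : ZMod m) = ((e + 1 + ((0 : Fin (n + 1)) : ℕ) : ℕ) : ZMod m) := by
            rw [Fin.val_zero, add_zero]
          rw [h0, hW]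
        · rw [Fin.snoc_castSucc, Fin.val_succ, Fin.val_castSucc, hR]
    have hfree : ∀ j : Fin n, bKernel ρ β M (Sum.elim W R (ε.symm (((e + 1 + (j : ℕ) : ℕ) : ZMod m))))
        (Sum.elim W R (ε.symm (((e + 2 + (j : ℕ) : ℕ) : ZMod m)))) = bKernel ρ β M (W (Fin.castSucc j)) (W j.succ) := fun j => by
      have h1 : (((e + 1 + (j : ℕ) : ℕ) : ZMod m)) = ((e + 1 + ((Fin.castSucc j : Fin (n + 1)) : ℕ) : ℕ) : ZMod m) := by
        rw [Fin.val_castSucc]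
      have h2 : (((e + 2 + (j : ℕ) : ℕ) : ZMod m)) = ((e + 1 + ((j.succ : Fin (n + 1)) : ℕ) : ℕ) : ZMod m) := by
        rw [Fin.val_succ]; congr 1; omega
      rw [h1, h2, hW, hW]
    simp only [hF, hΦ]
    rw [hvL, hvR]
    simp only [hfree]
  -- measurability / boundedness of `Φ`
  have hΦm : ∀ W : Fin (n + 1) → ℕ × HalfCfg S S G,
      Measurable fun q : (ℕ × HalfCfg S S G) × ((Fin e → ℕ × HalfCfg S S G) × (Fin e → ℕ × HalfCfg S S G)) =>
        Φ W q.1 q.2.1 q.2.2 := fun W => by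
    simp only [hΦ]
    refine Measurable.mul ?_ ?_
    · have h := (hHm.comp (measurable_cons_snoc (S := S) (G := G) (e := e))).comp
        ((measurable_fst.prodMk measurable_const).prodMk measurable_snd.fst :
          Measurable fun q : (ℕ × HalfCfg S S G) × ((Fin e → ℕ × HalfCfg S S G) × (Fin e → ℕ × HalfCfg S S G)) =>
            ((q.1, W (Fin.last n)), q.2.1))
      simpa only [Function.comp_def] using h
    · have h := (hHm.comp (measurable_cons_snoc (S := S) (G := G) (e := e))).comp
        ((measurable_fst.prodMk measurable_const).prodMk measurable_snd.snd :
          Measurable fun q : (ℕ × HalfCfg S S G) × ((Fin e → ℕ × HalfCfg S S G) × (Fin e → ℕ × HalfCfg S S G)) =>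
            ((q.1, W 0), q.2.2))
      simpa only [Function.comp_def] using h
  have hΦb : ∀ W c UL UR, |Φ W c UL UR| ≤ (C ^ (e + 1) * B) * (C ^ (e + 1) * B) := fun W c UL UR => by
    simp only [hΦ]
    rw [abs_mul]
    exact mul_le_mul (hHb _) (hHb _) (abs_nonneg _) (by positivity)
  -- ∫ over the interior coordinates gives the block kernel
  have hinner : ∀ W : Fin (n + 1) → ℕ × HalfCfg S S G,
      ∫ R : Unit ⊕ (Fin e ⊕ Fin e) → ℕ × HalfCfg S S G,
          Φ W (R (Sum.inl ())) (fun i => R (Sum.inr (Sum.inl i))) (fun i => R (Sum.inr (Sum.inr i)))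
          ∂(Measure.pi fun _ => tMeasure S G Nc β M) =
        blockKernel S G Nc ρ β M f (W (Fin.last n)) (W 0) := by
    intro W
    rw [integral_pi_split (tMeasure S G Nc β M) (Equiv.refl (Unit ⊕ (Fin e ⊕ Fin e)))]
    simp only [Equiv.refl_symm, Equiv.refl_apply, Sum.elim_inl, Sum.elim_inr]
    -- Fubini: centre outside
    have hint : Integrable (fun p : (Unit → ℕ × HalfCfg S S G) × (Fin e ⊕ Fin e → ℕ × HalfCfg S S G) =>
        Φ W (p.1 ()) (fun i => p.2 (Sum.inl i)) (fun i => p.2 (Sum.inr i)))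
        ((Measure.pi fun _ : Unit => tMeasure S G Nc β M).prod (Measure.pi fun _ : Fin e ⊕ Fin e => tMeasure S G Nc β M)) := by
      have hm' : Measurable fun p : (Unit → ℕ × HalfCfg S S G) × (Fin e ⊕ Fin e → ℕ × HalfCfg S S G) =>
          Φ W (p.1 ()) (fun i => p.2 (Sum.inl i)) (fun i => p.2 (Sum.inr i)) := by
        have hA : Measurable fun p : (Unit → ℕ × HalfCfg S S G) × (Fin e ⊕ Fin e → ℕ × HalfCfg S S G) => p.1 () :=
          (measurable_pi_apply ()).comp measurable_fst
        have hB' : Measurable fun p : (Unit → ℕ × HalfCfg S S G) × (Fin e ⊕ Fin e → ℕ × HalfCfg S S G) =>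
            fun i : Fin e => p.2 (Sum.inl i) :=
          measurable_pi_lambda _ fun i => (measurable_pi_apply (Sum.inl i)).comp measurable_snd
        have hC' : Measurable fun p : (Unit → ℕ × HalfCfg S S G) × (Fin e ⊕ Fin e → ℕ × HalfCfg S S G) =>
            fun i : Fin e => p.2 (Sum.inr i) :=
          measurable_pi_lambda _ fun i => (measurable_pi_apply (Sum.inr i)).comp measurable_snd
        have h := (hΦm W).comp (hA.prodMk (hB'.prodMk hC'))
        simpa only [Function.comp_def] using h
      exact Integrable.of_bound hm'.aestronglyMeasurable ((C ^ (e + 1) * B) * (C ^ (e + 1) * B)) (ae_of_all _ fun p => by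
        rw [Real.norm_eq_abs]; exact hΦb _ _ _ _)
    rw [integral_prod _ hint]
    simp only
    rw [integral_pi_unique (tMeasure S G Nc β M)
      (F := fun c' : Unit → ℕ × HalfCfg S S G => ∫ U : Fin e ⊕ Fin e → ℕ × HalfCfg S S G,
        Φ W (c' ()) (fun i => U (Sum.inl i)) (fun i => U (Sum.inr i)) ∂(Measure.pi fun _ => tMeasure S G Nc β M))]
    unfold blockKernel
    refine integral_congr_ae (ae_of_all _ fun c => ?_)
    dsimp only
    rw [integral_pi_split (tMeasure S G Nc β M) (Equiv.refl (Fin e ⊕ Fin e))]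
    simp only [Equiv.refl_symm, Equiv.refl_apply, Sum.elim_inl, Sum.elim_inr, hΦ]
    rw [integral_prod_mul (μ := Measure.pi fun _ : Fin e => tMeasure S G Nc β M) (ν := Measure.pi fun _ : Fin e => tMeasure S G Nc β M)
      (fun UL : Fin e → ℕ × HalfCfg S S G => halfBlock ρ β M f (Fin.cons c (Fin.snoc UL (W (Fin.last n)))))
      (fun UR : Fin e → ℕ × HalfCfg S S G => halfBlock ρ β M f (Fin.cons c (Fin.snoc UR (W 0))))]
    simp only [halfBlockT]
  -- assemble: split the cycle into window and interior, Fubini, and the inner computation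
  rw [integral_pi_split (tMeasure S G Nc β M) ε F]
  have hint : Integrable (fun p : (Fin (n + 1) → ℕ × HalfCfg S S G) × (Unit ⊕ (Fin e ⊕ Fin e) → ℕ × HalfCfg S S G) =>
      F (fun t => Sum.elim p.1 p.2 (ε.symm t)))
      ((Measure.pi fun _ : Fin (n + 1) => tMeasure S G Nc β M).prod
        (Measure.pi fun _ : Unit ⊕ (Fin e ⊕ Fin e) => tMeasure S G Nc β M)) := by
    have hm' : Measurable fun p : (Fin (n + 1) → ℕ × HalfCfg S S G) × (Unit ⊕ (Fin e ⊕ Fin e) → ℕ × HalfCfg S S G) =>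
        F (fun t => Sum.elim p.1 p.2 (ε.symm t)) := by
      have h := hFm.comp (measurable_sumElim_symm (S := S) (G := G) ε)
      exact h
    have hb' : ∀ p : (Fin (n + 1) → ℕ × HalfCfg S S G) × (Unit ⊕ (Fin e ⊕ Fin e) → ℕ × HalfCfg S S G),
        ‖F (fun t => Sum.elim p.1 p.2 (ε.symm t))‖ ≤ Cb ^ n * ((C ^ (e + 1) * B) * (C ^ (e + 1) * B)) := fun p =>
      (Real.norm_eq_abs _).le.trans (hFb (fun t => Sum.elim p.1 p.2 (ε.symm t)))
    exact Integrable.of_bound hm'.aestronglyMeasurable _ (ae_of_all _ hb')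
  rw [integral_prod _ hint]
  refine integral_congr_ae (ae_of_all _ fun W => ?_)
  dsimp only
  simp_rw [hkey W]
  rw [integral_const_mul, hinner W]

/-! ## §3 ★★ The sandwich layout of the tree's trace formula -/

/-- ★★ **Sandwich form**: with the window re-indexed by one step (`V s = W (s-1)`, a measure-preserving relabelling of `μ̃^{⊗(n+1)}`),
`∫ Θf · f · ∏_t e^{β even_t} e^{β odd_t} dP = ∫ blockKernel f (V 0) (V 1) · ∏_{t : Fin n} 𝔟(V (t+1), V (t+2)) dμ̃^{⊗ Fin (n+1)}(V)` — the
block kernel on the bond `0 → 1` followed by `n` reweighted lifted kernels around the cycle, exactly the layout of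
`HermitianKernelSandwichedTrace.integral_cyclic_bond_insert_eq_integral_iterate_rclike` / `PositiveKernelSpectralTrace.hasSum_integral_iterate_insert_one`. -/
theorem integral_obsLR_mul_pairChain_eq_sandwich (hρ : Continuous ρ) {β : ℝ} (hβ : 0 ≤ β)
    (hρu : ∀ g, ρ g ∈ Matrix.unitaryGroup (Fin Nc) ℂ) {M : ℝ}
    (hM : ∀ (Y : HalfCfg S S G) (j : Fin (featDim S Nc)), |bondVec ρ Y j| ≤ M) {m n e : ℕ} [NeZero m]
    (hm : m = n + 2 * e + 2) {f : (Fin (e + 1) → HalfCfg S S G) → (Fin (e + 1) → HalfCfg S S G) → ℝ}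
    (hf : Measurable (uncurry f)) {B : ℝ} (hB : ∀ Y X, |f Y X| ≤ B) :
    ∫ P : ZMod m → HalfCfg S S G × HalfCfg S S G,
        obsL f P * obsR f P * ∏ t : ZMod m, Real.exp (β * evenActionU ρ (P t).1 (P t).2 (P (t + 1)).1) *
          Real.exp (β * oddActionU ρ (P t).2 (P (t + 1)).1 (P (t + 1)).2)
        ∂(Measure.pi fun _ : ZMod m => (halfHaar S G).prod (halfHaar S G)) =
      ∫ V : Fin (n + 1) → ℕ × HalfCfg S S G,
        blockKernel S G Nc ρ β M f (V 0) (V 1) * ∏ t : Fin n, bKernel ρ β M (V t.succ) (V (t.succ + 1))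
        ∂(Measure.pi fun _ => tMeasure S G Nc β M) := by
  haveI := isFiniteMeasure_tMeasure (S := S) (G := G) (Nc := Nc) hβ M
  rw [integral_obsLR_mul_pairChain_eq_blockKernel ρ hρ hβ hρu hM hm hf hB]
  -- relabel the window: `W = V ∘ (· + 1)` via `piCongrLeft (subRight 1)`
  have hmp := measurePreserving_piCongrLeft (fun _ : Fin (n + 1) => tMeasure S G Nc β M) (Equiv.subRight (1 : Fin (n + 1)))
  rw [← hmp.integral_comp']
  refine integral_congr_ae (ae_of_all _ fun V => ?_)
  have happ : ∀ s : Fin (n + 1), (MeasurableEquiv.piCongrLeft (fun _ : Fin (n + 1) => ℕ × HalfCfg S S G)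
      (Equiv.subRight (1 : Fin (n + 1)))) V s = V (s + 1) := fun s => by
    have h := Equiv.piCongrLeft_apply_apply (P := fun _ : Fin (n + 1) => ℕ × HalfCfg S S G) (e := Equiv.subRight (1 : Fin (n + 1)))
      V (s + 1)
    rw [Equiv.subRight_apply, add_sub_cancel_right] at h
    rw [MeasurableEquiv.coe_piCongrLeft]
    exact h
  dsimp only
  simp only [happ, Fin.last_add_one, zero_add, Fin.coeSucc_eq_succ, mul_comm]

end Sandwich

end Summit.QuantumFields.YangMills.Cruxes.DiagonalMirrorRPR.SignTwistedDiagonalTrace.WilsonDiagonal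

end
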